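import Literature.MathematicalPhysics.QuantumFieldTheory.Balaban1983to89.B15Prop1RealChartFamilyExplicit
import Literature.MathematicalPhysics.QuantumFieldTheory.Balaban1983to89.B15Prop1LinearisedDatumCoordinates

/-!
# `Balaban1983to89.B15Prop1RealChartFamilyVelocity` — [Balaban1985Variational] = «[15]», Thm 1 p. 279, (15) p. 280, Sect. G (172) p. 305 («`H₁`», the derivative of the minimiser),
# Prop. 9 (190) p. 309; [Balaban1988Convergent] = «[III]», (2.12)–(2.14) pp. 256–257; [Balaban1989LargeFieldI] = «[IV]», (1.74) p. 192, Prop. 1 p. 194; [Balaban1989LargeFieldII] =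
# «[LF-II]», (1.12) p. 359, (1.19) p. 360; [HormanderSCV1973] Thm 2.2.7:
# ★★★ THE LETTER (K) OF THE N12∕s1 ASSEMBLY FOR THE (K′) FAMILY — THE VELOCITY `X_f′(0)` OF THE REAL MINIMISER CHART FAMILY IS BOUNDED, PER BOND, BY `8·𝓐₀∕R·‖X‖`
# (operator norm) FROM (J0′)'s THREE CLAUSES

Honest framing: statement-level skeleton of published theorems with citation tags; proofs where landed; nothing here is a claim about the
Yang–Mills mass gap.  Cell `pub-ymgap`, HUMAN RULING D-0154 (R399 (3a) width seats), seat `pub-ymgap-dag-n12-w5` (g2; N12 = [B15]; self-located on the lane owner's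
letter list, bus l.30272: «package (N) per (i,V_k) ← n12-w5 (K′) + … + (K) + …», CLAIM-1 l.30330); count-neutral helper of K1⁷ (`stmt-QuantumFields-20542`); N12 NOT
discharged; finite 𝕋⁴ at fixed ε; nothing continuum ∕ OS ∕ mass-gap ∕ Clay.

WHY.  In the assembled endpoint `B15Prop1EndpointNearFlatLetters.…_ofNearFlatLetters_oneSided` (p610003) the binder `hNF` asks, per instance `i` and base field `V_k` in the strict
guard, for `∃ U₀ X_f` with the (K′) clauses AND, among the linearised letters, (K) `p (fderiv ℝ X_f 0 X) ≤ K_c i · ‖X‖` for every slice vector `X` (dag-n12-w4's skeleton letter «the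
velocity of the family», print's `H₁ = ∂U∕∂V` of [15] Sect. G (172)).  The (K′) producer (`B15Prop1RealChartFamilyFromMinimiserChart`, p608072) hides `X_f` behind `∃`, so (K) must be
exported WITH it.  Here it is: for the explicit family `X_f Y (b) = φ(Re logCoordC(U₀(b)⋆ · Ũ(0, ι ιA Y)(b)))` the chain rule gives
`X_f′(0) X (b) = φ(Re T(U₀(b)⋆ · DŨ(0)(0, ι ιA X)(b)))` with `T = D logCoordC(1)` (dag-n12-w1's `hasFDerivAt_logCoordC_one`, p606071); `‖φ(y)‖_op = |y|` (`quatMatrix` is an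
`L²`-operator isometry), `|Re w| ≤ |w|`, `|T(U⋆N)_a| ≤ ½ Σ|N_ij|` (the sibling's `norm_trace_genE_mul_star_mul_le`), and each entry of `N = DŨ(0) v` is a directional derivative of an
entry of the chart, `≤ K₁‖v‖` under a chart-velocity letter — in particular `K₁ = 2𝓐₀∕R` by Cauchy's inequality from (J0′)'s SECOND clause «`‖Ũ z b a c‖ ≤ 𝓐₀` on `ball 0 R`»
(the sibling's `norm_fderiv_apply_le_of_forall_mem_ball`), the clause p608072 did not use.  Result: `‖X_f′(0) X (b)‖_op ≤ 8·𝓐₀∕R·‖X‖` and, in the pinned Hilbert–Schmidt norm of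
`𝔰𝔲(2)` (`‖φ y‖² = 2|y|²`), `‖X_f′(0) X (b)‖ ≤ 12·𝓐₀∕R·‖X‖`; the knit's seminorm `p ≤ c·‖·‖` then has `K_c i := 12·c·𝓐₀ i∕R_i` with `R_i` the ONE radius of `hMinC i K` on the
compact closed guard — an O(1) constant in [15] (172), existential in the tree (said so).

CONTENTS (theorems only; no `def`, no `instance`, no `sorry`).
* §1 ★★ `norm_fderiv_realChartFamily_apply_le` — the velocity of the explicit family from a chart-velocity letter `‖D(Ũ · b a c)(0) v‖ ≤ K₁‖v‖`: `≤ 4K₁‖X‖` (op), `≤ 6K₁‖X‖` (HS).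
* §2 ★★★ `exists_realChartFamily_velocity_of_minimiserChart` — p608072's hypotheses + (J0′) clause 2 ⊢ the (K′) package AND the per-bond velocity bounds `8·𝓐₀∕R·‖X‖` ∕ `12·𝓐₀∕R·‖X‖`;
  ★★ `exists_realChartFamily_hval_velocity_atRecord` — the record edition ((c3) of p608072: `avOfRecord F 2 Kt` ∕ `regMSCoPOfRecord F 2 ν Kt k′ Ω` ∕ `Bj M₁ Z k`, binder triple, `hval`) with velocity.
HONEST SCOPE: finite-dimensional calculus (chain rule, Cauchy's inequality on complex lines, `2×2` trace ∕ unitary-entry bookkeeping) on the tree's objects; (J0′) — the EXISTENCE of the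
holomorphic minimiser chart with its bound, [15] Prop. 9 (190) ∕ Thm 1 — stays a HYPOTHESIS (producer: the dag-n12-w1 lineage's `hMin…` theorems, themselves modulo [15] Thm 1's displayed
letters); the multiplier letter (μ) and the A₀-gauge near-flatness `hU` of `U₀` are NOT touched; nothing of Bałaban's estimates is asserted; N12 NOT discharged; K1⁷ NOT closed.
-/

noncomputable section

open Set Metric Filter
open scoped Topology ContDiff Matrix.Norms.L2Operator ComplexConjugate

namespace Literature.MathematicalPhysics.QuantumFieldTheory.Balaban1983to89.B15Prop1RealChartFamilyVelocity

open B15SU2ChartHolomorphic (genE logCoordC)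

/-! ## §1  The velocity of the explicit family from a chart-velocity letter -/

section Velocity

open B15Prop1SliceCoordinates (GaugeSlice ιA norm_ιA_apply_le)
open B15Prop1SliceTaylorCalculus (ιAc cplxSliceL cplxSliceL_apply ιAc_cplxSlice)
open B15Prop1ChartCalculusSU2 (E3)
open T4CubeChartGnomonic (SU2)
open T4Continuum B15DeterminingSets GaugeField
open T4AdjointCovarianceUnitary (lieSU)
open Node00
open B15Prop1AnalyticExtClause (cplxVec norm_cplxVec)
open Literature.MathematicalPhysics.QuantumLattice (quatMatrix)
open T4HaarSU2ExpChart (imQuat norm_imQuat)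
open T4QuatExpLog (norm_quatMatrix)
open B15Prop1RealChartFamilyFromMinimiserChart (contDiffOn_matrix_of_entries)
open B15Prop1LinearisedDatumCoordinates (exists_logCoordCLM hasFDerivAt_logCoordC_one)
open B15Prop1RealChartFamilyExplicit (norm_trace_genE_mul_star_mul_le norm_euclidean_three_le_two_mul exists_reCoordCLM cplxVec_pair_zero)

variable {P : Params} {k : ℕ} [DecidableEq (PBond P k)]

/-- ★★ **THE VELOCITY OF THE EXPLICIT FAMILY AT `0`, FROM A CHART-VELOCITY LETTER.**  For the explicit family `X_f` of `realChartFamily_explicit`: if the entries of the chart `Ũ`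
have directional derivatives at the origin bounded by `K₁` (`‖D(Ũ · b a c)(0) v‖ ≤ K₁‖v‖` — e.g. by Cauchy's inequality, `B15Prop1RealChartFamilyExplicit` §1, or by an `H₁`-type bound [15] (172)), then for every slice
vector `X` and every bond `b` the derivative `X_f′(0) X (b) = φ(Re T(U₀(b)⋆ · DŨ(0)(0, ι ιA X)(b)))` (`T = D logCoordC(1)`, dag-n12-w1's `hasFDerivAt_logCoordC_one`) satisfies
`‖X_f′(0) X (b)‖_op ≤ 4K₁‖X‖` (the `L²`-operator norm of its matrix — `|φ(y)|_op = |y|`, `|Re w| ≤ |w|`, `|tr(E_a U⋆ N)| ≤ Σ|N_ij|` for unitary `E_a U⋆`) and `‖X_f′(0) X (b)‖ ≤ 6K₁‖X‖` in the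
pinned Hilbert–Schmidt norm of `𝔰𝔲(2)` (`‖φ y‖² = 2|y|²`).  This is the letter (K) of the near-flat package for the (K′) family, producer side.
[cite: Balaban1985Variational, Sect. G (172) p.305, Prop. 9 (190) p.309; Balaban1989LargeFieldII, (1.12) p.359, (1.19) p.360; Balaban1985Averaging, (17),(19),(21) p.21] -/
theorem norm_fderiv_realChartFamily_apply_le (S : Set (Site P k)) (T : Finset (PBond P k))
    (φ : EuclideanSpace ℝ (Fin 3) →ₗ[ℝ] lieSU (Fin 2)) (hφ : ∀ v, ((φ v : lieSU (Fin 2)) : Matrix (Fin 2) (Fin 2) ℂ) = quatMatrix (imQuat v))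
    (U₀ : GaugeField P 0 SU2) {R : ℝ} (hR : 0 < R)
    (Ũ : VecField P k (EuclideanSpace ℂ (Fin 3)) × VecField P k (EuclideanSpace ℂ (Fin 3)) → PBond P 0 → Matrix (Fin 2) (Fin 2) ℂ)
    (hdiff : ∀ b a c, DifferentiableOn ℂ (fun z => Ũ z b a c) (ball 0 R))
    (hU₀eq : ∀ b, Ũ (cplxVec (0 : VecField P k E3), cplxVec (0 : VecField P k E3)) b = ((U₀ b : SU2) : Matrix (Fin 2) (Fin 2) ℂ))
    (Xf : GaugeSlice S T E3 → PBond P 0 → lieSU (Fin 2))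
    (hXf : Xf = fun Y b => φ (WithLp.toLp 2 fun a =>
      (logCoordC (star ((U₀ b : SU2) : Matrix (Fin 2) (Fin 2) ℂ) * Ũ (cplxVec (0 : VecField P k E3), cplxVec (ιA S T Y)) b) a).re))
    {K₁ : ℝ} (hK₁ : 0 ≤ K₁)
    (hvel : ∀ b a c (v : VecField P k (EuclideanSpace ℂ (Fin 3)) × VecField P k (EuclideanSpace ℂ (Fin 3))),
      ‖fderiv ℂ (fun z => Ũ z b a c) 0 v‖ ≤ K₁ * ‖v‖)
    (X : GaugeSlice S T E3) (b : PBond P 0) :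
    ‖((fderiv ℝ Xf 0 X b : lieSU (Fin 2)) : Matrix (Fin 2) (Fin 2) ℂ)‖ ≤ 4 * K₁ * ‖X‖ ∧ ‖fderiv ℝ Xf 0 X b‖ ≤ 6 * K₁ * ‖X‖ := by
  haveI : ContinuousSMul ℝ (GaugeSlice S T E3) := IsBoundedSMul.continuousSMul
  obtain ⟨Tl, hTl⟩ := exists_logCoordCLM
  obtain ⟨Rc, hRc⟩ := exists_reCoordCLM
  -- the linear parameter map of the slice
  obtain ⟨L, hL⟩ : ∃ L : GaugeSlice S T E3 →L[ℝ] VecField P k (EuclideanSpace ℂ (Fin 3)), ∀ Y, L Y = cplxVec (ιA S T Y) :=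
    ⟨((ιAc S T).restrictScalars ℝ).comp (cplxSliceL S T), fun Y => by
      rw [ContinuousLinearMap.comp_apply, ContinuousLinearMap.coe_restrictScalars', cplxSliceL_apply, ιAc_cplxSlice]⟩
  have hcv0 : cplxVec (0 : VecField P k E3) = 0 := by
    funext b'; ext i; simp [cplxVec]
  have hz0 : ((cplxVec (0 : VecField P k E3), cplxVec (0 : VecField P k E3)) :
      VecField P k (EuclideanSpace ℂ (Fin 3)) × VecField P k (EuclideanSpace ℂ (Fin 3))) = 0 := by
    rw [hcv0]; rfl
  have hg0 : ((cplxVec (0 : VecField P k E3), cplxVec (ιA S T (0 : GaugeSlice S T E3))) :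
      VecField P k (EuclideanSpace ℂ (Fin 3)) × VecField P k (EuclideanSpace ℂ (Fin 3))) = 0 := cplxVec_pair_zero S T
  have hg : HasFDerivAt (fun Y : GaugeSlice S T E3 => ((cplxVec (0 : VecField P k E3), cplxVec (ιA S T Y)) :
      VecField P k (EuclideanSpace ℂ (Fin 3)) × VecField P k (EuclideanSpace ℂ (Fin 3))))
      ((0 : GaugeSlice S T E3 →L[ℝ] VecField P k (EuclideanSpace ℂ (Fin 3))).prod L) 0 := by
    have hfun : (fun Y : GaugeSlice S T E3 => ((cplxVec (0 : VecField P k E3), cplxVec (ιA S T Y)) :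
        VecField P k (EuclideanSpace ℂ (Fin 3)) × VecField P k (EuclideanSpace ℂ (Fin 3)))) =
        fun Y => ((0 : VecField P k (EuclideanSpace ℂ (Fin 3))), L Y) := by
      funext Y
      rw [hL, hcv0]
    rw [hfun]
    exact (hasFDerivAt_const _ _).prodMk L.hasFDerivAt
  -- the chart is ℂ-differentiable at the origin as a matrix-valued map, with value `U₀`
  have hŨ : ∀ b', HasFDerivAt (fun z => Ũ z b') (fderiv ℂ (fun z => Ũ z b') 0) 0 := fun b' =>
    (((contDiffOn_matrix_of_entries isOpen_ball (hdiff b') 1).differentiableOn (by simp)).differentiableAt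
      (isOpen_ball.mem_nhds (mem_ball_self hR))).hasFDerivAt
  have hŨ0 : ∀ b', Ũ 0 b' = ((U₀ b' : SU2) : Matrix (Fin 2) (Fin 2) ℂ) := fun b' => by
    rw [← hz0]; exact hU₀eq b'
  -- the per-bond derivative
  obtain ⟨Dfam, hDfam⟩ : ∃ Dfam : PBond P 0 → (GaugeSlice S T E3 →L[ℝ] lieSU (Fin 2)), ∀ b', Dfam b' =
      (LinearMap.toContinuousLinearMap φ).comp (Rc.comp ((Tl.restrictScalars ℝ).comp
        (((star ((U₀ b' : SU2) : Matrix (Fin 2) (Fin 2) ℂ) • fderiv ℂ (fun z => Ũ z b') 0).restrictScalars ℝ).comp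
          ((0 : GaugeSlice S T E3 →L[ℝ] VecField P k (EuclideanSpace ℂ (Fin 3))).prod L)))) := ⟨_, fun _ => rfl⟩
  have hXfb : ∀ b', HasFDerivAt (fun Y => Xf Y b') (Dfam b') 0 := fun b' => by
    have h1 : HasFDerivAt (fun z => star ((U₀ b' : SU2) : Matrix (Fin 2) (Fin 2) ℂ) * Ũ z b')
        (star ((U₀ b' : SU2) : Matrix (Fin 2) (Fin 2) ℂ) • fderiv ℂ (fun z => Ũ z b') 0) 0 := (hŨ b').const_mul _
    have h1' : HasFDerivAt (fun z => star ((U₀ b' : SU2) : Matrix (Fin 2) (Fin 2) ℂ) * Ũ z b')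
        ((star ((U₀ b' : SU2) : Matrix (Fin 2) (Fin 2) ℂ) • fderiv ℂ (fun z => Ũ z b') 0).restrictScalars ℝ)
        ((cplxVec (0 : VecField P k E3), cplxVec (ιA S T (0 : GaugeSlice S T E3))) :
          VecField P k (EuclideanSpace ℂ (Fin 3)) × VecField P k (EuclideanSpace ℂ (Fin 3))) := by
      rw [hg0]
      exact h1.restrictScalars ℝ
    have h2 := h1'.comp (0 : GaugeSlice S T E3) hg
    have hM0 : star ((U₀ b' : SU2) : Matrix (Fin 2) (Fin 2) ℂ) *
        Ũ ((cplxVec (0 : VecField P k E3), cplxVec (ιA S T (0 : GaugeSlice S T E3)))) b' = 1 := by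
      rw [hg0, hŨ0 b']
      exact Matrix.mem_unitaryGroup_iff'.1 (U₀ b').prop.1
    have h3 : HasFDerivAt logCoordC Tl (star ((U₀ b' : SU2) : Matrix (Fin 2) (Fin 2) ℂ) *
        Ũ ((cplxVec (0 : VecField P k E3), cplxVec (ιA S T (0 : GaugeSlice S T E3)))) b') := by
      rw [hM0]; exact hasFDerivAt_logCoordC_one hTl
    have h4 := (h3.restrictScalars ℝ).comp (0 : GaugeSlice S T E3) h2
    have h5 := Rc.hasFDerivAt.comp (0 : GaugeSlice S T E3) h4
    have h6 := (LinearMap.toContinuousLinearMap φ).hasFDerivAt.comp (0 : GaugeSlice S T E3) h5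
    have hfun : (fun Y => Xf Y b') = (LinearMap.toContinuousLinearMap φ) ∘ (Rc ∘ (logCoordC ∘
        ((fun z => star ((U₀ b' : SU2) : Matrix (Fin 2) (Fin 2) ℂ) * Ũ z b') ∘
          fun Y : GaugeSlice S T E3 => ((cplxVec (0 : VecField P k E3), cplxVec (ιA S T Y)) :
            VecField P k (EuclideanSpace ℂ (Fin 3)) × VecField P k (EuclideanSpace ℂ (Fin 3)))))) := by
      funext Y
      rw [hXf]
      simp only [Function.comp_apply, LinearMap.coe_toContinuousLinearMap']
      congr 1
      ext a
      simp [hRc]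
    rw [hfun, hDfam]
    exact h6
  have hpi : HasFDerivAt Xf (ContinuousLinearMap.pi Dfam) 0 := hasFDerivAt_pi.2 hXfb
  have hderiv : fderiv ℝ Xf 0 = ContinuousLinearMap.pi Dfam := hpi.fderiv
  -- the value of the derivative at `(X, b)`
  have hv : ‖(((0 : VecField P k (EuclideanSpace ℂ (Fin 3))), cplxVec (ιA S T X)) :
      VecField P k (EuclideanSpace ℂ (Fin 3)) × VecField P k (EuclideanSpace ℂ (Fin 3)))‖ ≤ ‖X‖ := by
    rw [Prod.norm_def, norm_zero, norm_cplxVec, max_eq_right (norm_nonneg _)]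
    exact (pi_norm_le_iff_of_nonneg (norm_nonneg X)).2 fun b' => norm_ιA_apply_le X b'
  have hval : fderiv ℝ Xf 0 X b = φ (Rc (Tl (star ((U₀ b : SU2) : Matrix (Fin 2) (Fin 2) ℂ) *
      fderiv ℂ (fun z => Ũ z b) 0 (((0 : VecField P k (EuclideanSpace ℂ (Fin 3))), cplxVec (ιA S T X)))))) := by
    rw [hderiv, ContinuousLinearMap.pi_apply, hDfam]
    simp only [ContinuousLinearMap.comp_apply, LinearMap.coe_toContinuousLinearMap', ContinuousLinearMap.coe_restrictScalars',
      FunLike.coe_smul, Pi.smul_apply, smul_eq_mul, ContinuousLinearMap.prod_apply, FunLike.coe_zero, Pi.zero_apply, hL]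
  -- the entries of the chart velocity
  have hNent : ∀ i j, ‖fderiv ℂ (fun z => Ũ z b) 0 (((0 : VecField P k (EuclideanSpace ℂ (Fin 3))), cplxVec (ιA S T X))) i j‖
      ≤ K₁ * ‖X‖ := fun i j => by
    have hc : HasFDerivAt (fun z => Ũ z b i j)
        ((LinearMap.toContinuousLinearMap (Matrix.entryLinearMap ℂ ℂ i j)).comp (fderiv ℂ (fun z => Ũ z b) 0)) 0 :=
      (LinearMap.toContinuousLinearMap (Matrix.entryLinearMap ℂ ℂ i j)).hasFDerivAt.comp 0 (hŨ b)
    have hNij : fderiv ℂ (fun z => Ũ z b) 0 (((0 : VecField P k (EuclideanSpace ℂ (Fin 3))), cplxVec (ιA S T X))) i j =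
        fderiv ℂ (fun z => Ũ z b i j) 0 (((0 : VecField P k (EuclideanSpace ℂ (Fin 3))), cplxVec (ιA S T X))) := by
      rw [hc.fderiv]; rfl
    rw [hNij]
    exact (hvel b i j _).trans (mul_le_mul_of_nonneg_left hv hK₁)
  -- the coordinates of `y := Re T(U₀⋆ N)`
  have hya : ∀ a, ‖(Rc (Tl (star ((U₀ b : SU2) : Matrix (Fin 2) (Fin 2) ℂ) *
      fderiv ℂ (fun z => Ũ z b) 0 (((0 : VecField P k (EuclideanSpace ℂ (Fin 3))), cplxVec (ιA S T X)))))) a‖ ≤ 2 * K₁ * ‖X‖ := fun a => by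
    rw [hRc, hTl, Real.norm_eq_abs]
    refine (Complex.abs_re_le_norm _).trans ?_
    rw [norm_mul, norm_neg]
    calc ‖(1 / 2 : ℂ)‖ * ‖(genE a * (star ((U₀ b : SU2) : Matrix (Fin 2) (Fin 2) ℂ) *
          fderiv ℂ (fun z => Ũ z b) 0 (((0 : VecField P k (EuclideanSpace ℂ (Fin 3))), cplxVec (ιA S T X))))).trace‖
        ≤ ‖(1 / 2 : ℂ)‖ * ∑ i, ∑ j, ‖fderiv ℂ (fun z => Ũ z b) 0 (((0 : VecField P k (EuclideanSpace ℂ (Fin 3))), cplxVec (ιA S T X))) i j‖ :=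
          mul_le_mul_of_nonneg_left (norm_trace_genE_mul_star_mul_le (U₀ b).prop.1 a _) (norm_nonneg _)
      _ ≤ ‖(1 / 2 : ℂ)‖ * ∑ _i : Fin 2, ∑ _j : Fin 2, K₁ * ‖X‖ := by
          gcongr with i _ j _
          exact hNent i j
      _ = 2 * K₁ * ‖X‖ := by
          simp only [Finset.sum_const, Finset.card_univ, Fintype.card_fin]
          norm_num
          ring
  have hynorm : ‖Rc (Tl (star ((U₀ b : SU2) : Matrix (Fin 2) (Fin 2) ℂ) *
      fderiv ℂ (fun z => Ũ z b) 0 (((0 : VecField P k (EuclideanSpace ℂ (Fin 3))), cplxVec (ιA S T X)))))‖ ≤ 4 * K₁ * ‖X‖ := by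
    have h := norm_euclidean_three_le_two_mul _ hya
    linarith
  -- conclusion
  have hop : ‖((fderiv ℝ Xf 0 X b : lieSU (Fin 2)) : Matrix (Fin 2) (Fin 2) ℂ)‖ = ‖Rc (Tl (star ((U₀ b : SU2) : Matrix (Fin 2) (Fin 2) ℂ) *
      fderiv ℂ (fun z => Ũ z b) 0 (((0 : VecField P k (EuclideanSpace ℂ (Fin 3))), cplxVec (ιA S T X)))))‖ := by
    rw [hval, hφ, norm_quatMatrix, norm_imQuat]
  refine ⟨hop ▸ hynorm, ?_⟩
  have hsq : ‖fderiv ℝ Xf 0 X b‖ ^ 2 ≤ (6 * K₁ * ‖X‖) ^ 2 := by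
    rw [hval, B16Ineq19FlatSliceChart.norm_sq_lieSU2Coord hφ]
    have h0 : 0 ≤ K₁ * ‖X‖ := mul_nonneg hK₁ (norm_nonneg X)
    nlinarith [hynorm, norm_nonneg (Rc (Tl (star ((U₀ b : SU2) : Matrix (Fin 2) (Fin 2) ℂ) *
      fderiv ℂ (fun z => Ũ z b) 0 (((0 : VecField P k (EuclideanSpace ℂ (Fin 3))), cplxVec (ιA S T X))))))]
  exact (pow_le_pow_iff_left₀ (norm_nonneg _) (by positivity) two_ne_zero).1 hsq

end Velocity

/-! ## §2  The packaged letters: (K′) with its velocity (K), from (J0′)'s three clauses -/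

section Main

open B15Prop1SliceCoordinates (GaugeSlice ιA norm_ιA_apply_le)
open B15Prop1SliceTaylorCalculus (sliceFn)
open B15Prop1ChartCalculusSU2 (E3)
open T4CubeChartGnomonic (SU2)
open T4Continuum B15DeterminingSets GaugeField
open T4AdjointCovarianceUnitary (lieSU)
open Node00
open B16Sect1Backgrounds (expMul expMul_zero)
open B15Prop1AnalyticExtClause (cplxVec norm_cplxVec)
open B15Prop1ChartSU2 (su2Chart)
open Literature.MathematicalPhysics.QuantumLattice (quatMatrix)
open T4HaarSU2ExpChart (imQuat)
open B15Eq177ValueInvariance B15Sect1Instances B14.Eq213DetSet B14.Eq216Concrete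
open B15Prop1SliceHessianOfChartFamily (eventually_sliceFn_fun177std_bgMSCoPOfRecord_eq_wilsonAction4)
open B15Prop1RealChartFamilyFromMinimiserChart (binders_of_contDiffAt_two)
open B15Prop1RealChartFamilyExplicit (realChartFamily_explicit norm_fderiv_apply_le_of_forall_mem_ball)
open Literature.MathematicalPhysics.QuantumFieldTheory.BalabanImbrieJaffe1984to88.BIJ85Eq453GaugeField (qsstarGIter0)

variable {P : Params} {k : ℕ} [DecidableEq (PBond P k)]

/-- ★★★ **(K′) WITH ITS VELOCITY (K): THE REAL `C²` MINIMISER CHART FAMILY AND THE BOUND ON ITS DERIVATIVE AT `0`, FROM (J0′)'s THREE CLAUSES.**  Hypotheses =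
`B15Prop1RealChartFamilyFromMinimiserChart.exists_realChartFamily_of_minimiserChart` (p608072) VERBATIM plus (J0′)'s SECOND clause — the entrywise bound `‖Ũ z b a c‖ ≤ 𝓐₀` on
`ball 0 R` (`B15Prop1ClosedGuardUniformRadius` `hMinC`∕`hMinK`, second conjunct).  Conclusion: the (K′) package (a base minimiser `U₀`, a real family `X_f` with `X_f 0 = 0`, `C²` at
`0`, `expChart U₀ (X_f Y)` minimisers near `0`) AND, for every slice vector `X` and every bond `b`, `‖X_f′(0) X (b)‖_op ≤ 8·𝓐₀∕R·‖X‖` and `‖X_f′(0) X (b)‖ ≤ 12·𝓐₀∕R·‖X‖`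
(Cauchy's inequality on complex lines through the origin of the chart parameters, `B15Prop1RealChartFamilyExplicit` §1, feeds the chart-velocity letter of §1 with `K₁ = 2𝓐₀∕R`).  This is the letter (K)
«`p (fderiv ℝ X_f 0 X) ≤ K_c‖X‖`» of the assembled endpoint's package (N) (`B15Prop1EndpointNearFlatLetters`, p610003) for the (K′) family, up to the knit's choice of the
seminorm `p`; `K_c` is per instance through (J0′)'s ONE radius on the compact closed guard — an O(1) constant in [15] (172) («`|H₁|` bounded»), existential in the tree.
[cite: Balaban1985Variational, Thm 1 p.279, (15) p.280, Sect. G (172) p.305, Prop. 9 (190) p.309; Balaban1988Convergent, (2.12)–(2.14) pp.256–257; Balaban1989LargeFieldI, Prop. 1 p.194 (last clause); Balaban1989LargeFieldII, (1.12) p.359, (1.19) p.360; HormanderSCV1973, Thm 2.2.7] -/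
theorem exists_realChartFamily_velocity_of_minimiserChart (S : Set (Site P k)) (T : Finset (PBond P k))
    (φ : EuclideanSpace ℝ (Fin 3) →ₗ[ℝ] lieSU (Fin 2)) (hφ : ∀ v, ((φ v : lieSU (Fin 2)) : Matrix (Fin 2) (Fin 2) ℂ) = quatMatrix (imQuat v))
    (av : ∀ j, Averaging P j SU2) (reg : Set (GaugeField P 0 SU2)) (𝔹 : DetSet P)
    (ext : GaugeField P k SU2 → GaugeField P k SU2) (Vk : GaugeField P k SU2) {R : ℝ} (hR : 0 < R)
    (Ũ : VecField P k (EuclideanSpace ℂ (Fin 3)) × VecField P k (EuclideanSpace ℂ (Fin 3)) → PBond P 0 → Matrix (Fin 2) (Fin 2) ℂ)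
    (hdiff : ∀ b a c, DifferentiableOn ℂ (fun z => Ũ z b a c) (ball 0 R))
    {𝓐₀ : ℝ} (h𝓐 : ∀ z ∈ ball (0 : VecField P k (EuclideanSpace ℂ (Fin 3)) × VecField P k (EuclideanSpace ℂ (Fin 3))) R, ∀ b a c, ‖Ũ z b a c‖ ≤ 𝓐₀)
    (hreal : ∀ p B' : VecField P k E3, ‖p‖ < R → ‖B'‖ < R → ∃ U' : GaugeField P 0 SU2,
      (∀ b, Ũ (cplxVec p, cplxVec B') b = ((U' b : SU2) : Matrix (Fin 2) (Fin 2) ℂ)) ∧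
        IsMinimizer av reg 𝔹 (avgFamily av (qsstarGIter0 k (expMul su2Chart B' (ext (expMul su2Chart p Vk))))) U') :
    ∃ U₀ : GaugeField P 0 SU2, ∃ Xf : GaugeSlice S T E3 → PBond P 0 → lieSU (Fin 2),
      Xf 0 = 0 ∧ ContDiffAt ℝ 2 Xf 0 ∧ IsMinimizer av reg 𝔹 (avgFamily av (qsstarGIter0 k (ext Vk))) U₀ ∧
        (∀ᶠ Y in 𝓝 (0 : GaugeSlice S T E3),
          IsMinimizer av reg 𝔹 (avgFamily av (qsstarGIter0 k (expMul su2Chart (ιA S T Y) (ext Vk)))) (expChart U₀ (Xf Y))) ∧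
        ∀ (X : GaugeSlice S T E3) (b : PBond P 0),
          ‖((fderiv ℝ Xf 0 X b : lieSU (Fin 2)) : Matrix (Fin 2) (Fin 2) ℂ)‖ ≤ 8 * 𝓐₀ / R * ‖X‖ ∧ ‖fderiv ℝ Xf 0 X b‖ ≤ 12 * 𝓐₀ / R * ‖X‖ := by
  -- the base minimiser: the `hreal` witness at `(p, B′) = (0, 0)`
  have h0R : ‖(0 : VecField P k E3)‖ < R := by simpa using hR
  obtain ⟨U₀, hU₀eq, hU₀min⟩ := hreal 0 0 h0R h0R
  rw [expMul_zero, expMul_zero] at hU₀min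
  -- the explicit family and its three clauses
  set Xf : GaugeSlice S T E3 → PBond P 0 → lieSU (Fin 2) := fun Y b => φ (WithLp.toLp 2 fun a =>
      (logCoordC (star ((U₀ b : SU2) : Matrix (Fin 2) (Fin 2) ℂ) * Ũ (cplxVec (0 : VecField P k E3), cplxVec (ιA S T Y)) b) a).re) with hXf
  obtain ⟨h0, h2, hmin⟩ := realChartFamily_explicit S T φ hφ av reg 𝔹 ext Vk hR Ũ hdiff hreal U₀ hU₀eq Xf hXf
  -- the chart-velocity letter by Cauchy's inequality, `K₁ = 2𝓐₀/R`
  have hvel : ∀ b a c (v : VecField P k (EuclideanSpace ℂ (Fin 3)) × VecField P k (EuclideanSpace ℂ (Fin 3))),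
      ‖fderiv ℂ (fun z => Ũ z b a c) 0 v‖ ≤ 2 * 𝓐₀ / R * ‖v‖ := fun b a c v =>
    norm_fderiv_apply_le_of_forall_mem_ball hR (hdiff b a c) (fun z hz => h𝓐 z hz b a c) v
  refine ⟨U₀, Xf, h0, h2, hU₀min, hmin, fun X b => ?_⟩
  have h𝓐0 : 0 ≤ 𝓐₀ := (norm_nonneg _).trans (h𝓐 0 (mem_ball_self hR) b 0 0)
  have hK₁ : 0 ≤ 2 * 𝓐₀ / R := by positivity
  obtain ⟨hop, hhs⟩ := norm_fderiv_realChartFamily_apply_le S T φ hφ U₀ hR Ũ hdiff hU₀eq Xf hXf hK₁ hvel X b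
  constructor
  · calc ‖((fderiv ℝ Xf 0 X b : lieSU (Fin 2)) : Matrix (Fin 2) (Fin 2) ℂ)‖ ≤ 4 * (2 * 𝓐₀ / R) * ‖X‖ := hop
      _ = 8 * 𝓐₀ / R * ‖X‖ := by ring
  · calc ‖fderiv ℝ Xf 0 X b‖ ≤ 6 * (2 * 𝓐₀ / R) * ‖X‖ := hhs
      _ = 12 * 𝓐₀ / R * ‖X‖ := by ring

/-- ★★ **THE RECORD EDITION WITH VELOCITY — THE SHAPE THE ASSEMBLED ENDPOINT's `hNF` CONSUMES.**  At the endpoints' objects (NODE 00's averaging `avOfRecord F 2 Kt`, class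
`regMSCoPOfRecord F 2 ν Kt k′ Ω`, determining set `𝐁_k(Z) = Bj M₁ Z k`): from (J0′)'s three clauses at one base field `Ṽ_k` — the family `(U₀, X_f)` with `X_f 0 = 0`, `C²` at `0`, its
binder triple, the base minimiser, the minimiser property near `0`, print's value identity along the slice `sliceFn S T (fun177std (bgMSCoPOfRecord …) M₁ Z k) Ṽ_k Y = A(expChart U₀ (X_f Y))`
(`B15Prop1RealChartFamilyFromMinimiserChart` (c3) ∕ the lane's `eventually_sliceFn_fun177std_bgMSCoPOfRecord_eq_wilsonAction4`), AND the velocity letter (K) per bond in both matrix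
currencies (`≤ 8·𝓐₀∕R·‖X‖` operator, `≤ 12·𝓐₀∕R·‖X‖` Hilbert–Schmidt).  Conjuncts 2–4 + (K) of `hNF` in `B15Prop1EndpointNearFlatLetters` (p610003) for the (K′) family, modulo the
knit's seminorm dictionary `p ≤ c·‖·‖`. [cite: Balaban1989LargeFieldI, (1.74) p.192, (1.77) and Prop. 1 p.194; Balaban1989LargeFieldII, p.359, (1.12) p.359; Balaban1988Convergent, (2.12) p.256; Balaban1985Variational, (2) p.278, Sect. G (172) p.305, Prop. 9 (190) p.309] -/
theorem exists_realChartFamily_hval_velocity_atRecord {F : T4Family} (ν : Stage7Numerics) (Kt k' : ℕ) (Ω : ℕ → Set (Site (F.P Kt) 0))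
    (M₁ : ℕ) (Z : Set (Site (F.P Kt) 0)) {k : ℕ} [DecidableEq (PBond (F.P Kt) k)] (S : Set (Site (F.P Kt) k)) (T : Finset (PBond (F.P Kt) k))
    (φ : EuclideanSpace ℝ (Fin 3) →ₗ[ℝ] lieSU (Fin 2)) (hφ : ∀ v, ((φ v : lieSU (Fin 2)) : Matrix (Fin 2) (Fin 2) ℂ) = quatMatrix (imQuat v))
    (ext : GaugeField (F.P Kt) k SU2 → GaugeField (F.P Kt) k SU2) (Vk : GaugeField (F.P Kt) k SU2) {R : ℝ} (hR : 0 < R)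
    (Ũ : VecField (F.P Kt) k (EuclideanSpace ℂ (Fin 3)) × VecField (F.P Kt) k (EuclideanSpace ℂ (Fin 3)) →
      PBond (F.P Kt) 0 → Matrix (Fin 2) (Fin 2) ℂ)
    (hdiff : ∀ b a c, DifferentiableOn ℂ (fun z => Ũ z b a c) (ball 0 R))
    {𝓐₀ : ℝ} (h𝓐 : ∀ z ∈ ball (0 : VecField (F.P Kt) k (EuclideanSpace ℂ (Fin 3)) × VecField (F.P Kt) k (EuclideanSpace ℂ (Fin 3))) R,
      ∀ b a c, ‖Ũ z b a c‖ ≤ 𝓐₀)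
    (hreal : ∀ p B' : VecField (F.P Kt) k E3, ‖p‖ < R → ‖B'‖ < R → ∃ U' : GaugeField (F.P Kt) 0 SU2,
      (∀ b, Ũ (cplxVec p, cplxVec B') b = ((U' b : SU2) : Matrix (Fin 2) (Fin 2) ℂ)) ∧
        IsMinimizer (avOfRecord F 2 Kt) (regMSCoPOfRecord F 2 ν Kt k' Ω) (Bj M₁ Z k)
          (avgFamily (avOfRecord F 2 Kt) (qsstarGIter0 k (expMul su2Chart B' (ext (expMul su2Chart p Vk))))) U') :
    ∃ U₀ : GaugeField (F.P Kt) 0 SU2, ∃ Xf : GaugeSlice S T E3 → PBond (F.P Kt) 0 → lieSU (Fin 2),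
      Xf 0 = 0 ∧ ContDiffAt ℝ 2 Xf 0 ∧
      HasFDerivAt Xf (fderiv ℝ Xf 0) 0 ∧ HasFDerivAt (fun Y => fderiv ℝ Xf Y) (fderiv ℝ (fderiv ℝ Xf) 0) 0 ∧
      (∀ᶠ Y in 𝓝 (0 : GaugeSlice S T E3), DifferentiableAt ℝ Xf Y) ∧
      IsMinimizer (avOfRecord F 2 Kt) (regMSCoPOfRecord F 2 ν Kt k' Ω) (Bj M₁ Z k) (avgFamily (avOfRecord F 2 Kt) (qsstarGIter0 k (ext Vk))) U₀ ∧
      (∀ᶠ Y in 𝓝 (0 : GaugeSlice S T E3),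
          IsMinimizer (avOfRecord F 2 Kt) (regMSCoPOfRecord F 2 ν Kt k' Ω) (Bj M₁ Z k)
            (avgFamily (avOfRecord F 2 Kt) (qsstarGIter0 k (expMul su2Chart (ιA S T Y) (ext Vk)))) (expChart U₀ (Xf Y))) ∧
      (∀ᶠ Y in 𝓝 (0 : GaugeSlice S T E3),
          sliceFn S T (fun177std (bgMSCoPOfRecord F 2 ν Kt k' Ω) M₁ Z k) (ext Vk) Y = wilsonAction4 (expChart U₀ (Xf Y))) ∧
        ∀ (X : GaugeSlice S T E3) (b : PBond (F.P Kt) 0),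
          ‖((fderiv ℝ Xf 0 X b : lieSU (Fin 2)) : Matrix (Fin 2) (Fin 2) ℂ)‖ ≤ 8 * 𝓐₀ / R * ‖X‖ ∧ ‖fderiv ℝ Xf 0 X b‖ ≤ 12 * 𝓐₀ / R * ‖X‖ := by
  obtain ⟨U₀, Xf, h0, h2, hmin0, hmin, hvel⟩ :=
    exists_realChartFamily_velocity_of_minimiserChart S T φ hφ (avOfRecord F 2 Kt) (regMSCoPOfRecord F 2 ν Kt k' Ω) (Bj M₁ Z k)
      ext Vk hR Ũ hdiff h𝓐 hreal
  obtain ⟨hd1, hd2, hdd⟩ := binders_of_contDiffAt_two h2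
  exact ⟨U₀, Xf, h0, h2, hd1, hd2, hdd, hmin0, hmin,
    eventually_sliceFn_fun177std_bgMSCoPOfRecord_eq_wilsonAction4 ν Kt k' Ω M₁ Z S T (ext Vk) hmin, hvel⟩

end Main

end Literature.MathematicalPhysics.QuantumFieldTheory.Balaban1983to89.B15Prop1RealChartFamilyVelocity

end
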